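import Summits.BirchSwinnertonDyer.BirchSwinnertonDyer.Theorems.PrintCf2DisegniPairTwoTameTransportNeg
import Summits.BirchSwinnertonDyer.BirchSwinnertonDyer.Theorems.PrintCf2DisegniPairTwoTamePeriodTransport
import Literature.NumberTheory.EllipticCurves.ImaginaryPeriod
import HarnessLib

/-!
# Road (C) `disegni-pair-two` on crux stmt-BirchSwinnertonDyer-20368 — BIRCH TRANSPORT on the period side for a NEGATIVE twist
# parameter and the `χ₈`-class defect key in BASE currency (`d < 0`): the period-ratio class constant CANCELS against the
# MINUS period ratio of the base

Cell `bsd-print-cf2`, width seat `bsd-line-cf2-p1-w8` g24; the `d < 0` twin of `PrintCf2DisegniPairTwoTamePeriodTransport.lean`,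
sequel of `PrintCf2DisegniPairTwoTameTransportNeg.lean` (the `2`-adic side). `--supports stmt-BirchSwinnertonDyer-20368` (helper).
THEOREMS ONLY (no `def`, no named fact, no `sorry`); conditional on every displayed hypothesis. BSD is not proved by any of this;
no summit statement is claimed; 20368 is not closed here.

## What is proved (`E` globally minimal good ordinary at `2`; `d < 0`, `d ≡ 1 (4)`, squarefree, `(d, N_E) = 1`; `V = C₀ • E^{(d)}`
globally minimal; `f_E`, `f_V` the newforms; `χ_d = (·/|d|)` odd; `c_∞(E) = #π₀(E(ℝ))`)

* §1 `plusPeriodRatio_negTwist_of_birch` (real algebra): from Birch's `c²·|d|·(Ω⁺_{f_V})² = (Ω⁻_{f_E})²`, Pal's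
  `Ω(V)·√|d| = |u₀|·c_∞(E)·|Ω⁻(E)|` (Thm. 3.2, `d < 0`) and a MINUS period ratio `μ_E·|Ω⁻(E)| = Ω⁻_{f_E}` of the base, the twist
  has the EXPLICIT plus period ratio `ϖ_V := μ_E/(|c·u₀|·c_∞(E))`: `ϖ_V·Ω(V) = Ω⁺_{f_V}`; `padicValRat_div_abs_mul_mul`.
* §2 ★★ `exists_plusPeriodRatio_negTwist`, ★★★ `valuation_deriv_add_plusPeriodRatio_negTwist`:
  **`v₂(D_V) + v₂(ϖ_V) + v₂(u(C₀)) + v₂(c_∞(E)) = v₂(D_{G⁻}) + v₂(μ_E)`** (`G⁻ = L⁻₂(f_E, |d|, α_E, χ_d, ·)`) — `c` CANCELS.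
* §3 ★★★ `defectKey_chi8_base_currency_neg` — `defectKey_chi8_modulo_descent_min` for a member `W` over `V = C₀ • E^{(d)}`, `d < 0`,
  RE-BASED: `v₂(q) + v₂(Tam W) + v₂(h₂) + v₂(u(C₀)) + v₂(c_∞(E)) = v₂(D_{G⁻}) + 2 + 2v₂(#W(ℚ)_tors) + v₂(μ_E)`. The cm7
  specialisation (`μ(cm7) = 1`, `c_∞(cm7) = 1`, `u(C₀) = ±1`) is the sequel `…TamePeriodTransportNegCm7.lean`.

References: B. Mazur, J. Tate, J. Teitelbaum, Invent. Math. 84 (1986) §I.8 [MazurTateTeitelbaum1986Invent]; V. Pal, Proc. AMS 140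
(2012) Prop. 2.5, Thm. 3.2 (case d < 0) [Pal2012]; D. Disegni, Compos. Math. 153 (2017) Thm. B [Disegni2017].
-/

set_option autoImplicit false
set_option linter.dupNamespace false

noncomputable section

open scoped Classical MatrixGroups ModularForm NumberField NumberTheorySymbols

open CongruenceSubgroup NumberField IsDedekindDomain WeierstrassCurve WeierstrassCurve.Affine.Point PowerSeries
  Literature.NumberTheory.EllipticCurves Literature.NumberTheory.EllipticCurves.ModularForms
  Literature.NumberTheory.EllipticCurves.Disegni2017 Literature.NumberTheory.GaloisRepresentations
  Literature.NumberTheory.EllipticCurves.GreenbergVatsal2000 Summit.BirchSwinnertonDyer.Rank1Residual.AdditivePotMult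

namespace Summit.BirchSwinnertonDyer.BirchSwinnertonDyer.Theorems.PrintCf2.DisegniPairTwo

/-! ### §1 Real and valuation algebra of the period transport (negative twist) -/

section AlgebraNeg

/-- **The plus period ratio of a negative twist, explicitly**: from `c²·D·P_V² = P_E²` (Birch, `D = |d|`),
`Ω_V·√D = |u₀|·n·Ω⁻_E` (Pal, `n = c_∞(E)`) and `μ_E·Ω⁻_E = P_E` with `P_V, P_E > 0`, `c, u₀ ≠ 0`, `n > 0`:
`(μ_E/(|c u₀|·n))·Ω_V = P_V`. [cite: MazurTateTeitelbaum1986Invent, §I.8] [cite: Pal2012, Thm. 3.2 (case d < 0)] -/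
theorem plusPeriodRatio_negTwist_of_birch {c μE u₀ : ℚ} {n : ℕ} {D ΩV ΩE PV PE : ℝ} (hD : 0 < D) (hc : c ≠ 0)
    (hu : u₀ ≠ 0) (hn : 0 < n) (hPV : 0 < PV) (hPE : 0 < PE) (hper : (c : ℝ) ^ 2 * D * PV ^ 2 = PE ^ 2)
    (hμE : (μE : ℝ) * ΩE = PE) (hPal : ΩV * Real.sqrt D = |(u₀ : ℝ)| * n * ΩE) :
    ((μE / (|c * u₀| * n) : ℚ) : ℝ) * ΩV = PV := by
  have hsd : 0 < Real.sqrt D := Real.sqrt_pos.mpr hD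
  have hsq : Real.sqrt D ^ 2 = D := Real.sq_sqrt hD.le
  have hcR : (0 : ℝ) < |(c : ℝ)| := abs_pos.mpr (by exact_mod_cast hc)
  have huR : (0 : ℝ) < |(u₀ : ℝ)| := abs_pos.mpr (by exact_mod_cast hu)
  have hnR : (0 : ℝ) < (n : ℝ) := by exact_mod_cast hn
  have h1 : ((μE / (|c * u₀| * n) : ℚ) : ℝ) * ΩV = PE / (|(c : ℝ)| * Real.sqrt D) := by
    rw [eq_div_iff (mul_pos hcR hsd).ne']
    push_cast
    rw [abs_mul]
    have : (μE : ℝ) / (|(c : ℝ)| * |(u₀ : ℝ)| * n) * ΩV * (|(c : ℝ)| * Real.sqrt D) =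
        (μE : ℝ) * (ΩV * Real.sqrt D) / (|(u₀ : ℝ)| * n) := by
      field_simp
    rw [this, hPal, ← hμE]
    field_simp
  have h2 : (PE / (|(c : ℝ)| * Real.sqrt D)) ^ 2 = PV ^ 2 := by
    rw [div_pow, mul_pow, sq_abs, hsq, ← hper]
    field_simp
  have h3 : 0 ≤ PE / (|(c : ℝ)| * Real.sqrt D) := (div_pos hPE (mul_pos hcR hsd)).le
  rw [h1]
  exact (pow_left_inj₀ h3 hPV.le two_ne_zero).mp h2

/-- `v_p(μ/(|c·u|·n)) = v_p(μ) − v_p(c) − v_p(u) − v_p(n)` for `μ, c, u, n ≠ 0`. [folklore] -/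
theorem padicValRat_div_abs_mul_mul {p : ℕ} [Fact p.Prime] {μ c u n : ℚ} (hμ : μ ≠ 0) (hc : c ≠ 0) (hu : u ≠ 0)
    (hn : n ≠ 0) :
    padicValRat p (μ / (|c * u| * n)) = padicValRat p μ - padicValRat p c - padicValRat p u - padicValRat p n := by
  have hcu : |c * u| ≠ 0 := abs_ne_zero.mpr (mul_ne_zero hc hu)
  rw [padicValRat.div hμ (mul_ne_zero hcu hn), padicValRat.mul hcu hn, padicValRat_abs_eq, padicValRat.mul hc hu]
  ring

/-- `c_∞(E) ∈ {1, 2}` is positive. [cite: Pal2012, Thm. 3.2 (case d < 0)] -/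
theorem numRealComponents_baseChange_pos (E : WeierstrassCurve ℚ) : 0 < (E.baseChange ℝ).numRealComponents := by
  rw [numRealComponents_baseChange_real]
  split_ifs <;> norm_num

end AlgebraNeg

/-! ### §2 The plus period ratio of a negative twist and the cancellation of Birch's constant -/

section TransportNeg

variable (E : WeierstrassCurve ℚ) [E.IsElliptic] [E.IsGloballyMinimal] {d : ℤ} {V : WeierstrassCurve ℚ}
  [V.IsElliptic] [V.IsGloballyMinimal] [NeZero (E.conductorNorm ℤ)] [NeZero (V.conductorNorm ℤ)] [NeZero d.natAbs]
  {fE : CuspForm (Gamma0 (E.conductorNorm ℤ)) 2} {fV : CuspForm (Gamma0 (V.conductorNorm ℤ)) 2}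

omit [E.IsGloballyMinimal] [V.IsElliptic] [V.IsGloballyMinimal] [NeZero d.natAbs] in
/-- ★★ **The plus period ratio of a NEGATIVE twist from the minus period ratio of the base.** For `μ_E ∈ ℚˣ` with
`μ_E·|Ω⁻(E)| = Ω⁻_{f_E}` and Birch's constant `c` (`c²·|d|·(Ω⁺_{f_V})² = (Ω⁻_{f_E})²`), `ϖ_V := μ_E/(|c·u(C₀)|·c_∞(E)) ∈ ℚˣ`
satisfies `ϖ_V·Ω(V) = Ω⁺_{f_V}` (Pal, `d < 0`: `Ω(V)·√|d| = |u(C₀)|·c_∞(E)·|Ω⁻(E)|`) and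
`v₂(ϖ_V) = v₂(μ_E) − v₂(c) − v₂(u(C₀)) − v₂(c_∞(E))`. No parametrisation datum of `V` is used.
[cite: MazurTateTeitelbaum1986Invent, §I.8] [cite: Pal2012, Thm. 3.2 (case d < 0)] -/
theorem exists_plusPeriodRatio_negTwist (hd : d < 0) {C₀ : VariableChange ℚ} (hV : C₀ • E.quadraticTwist (d : ℚ) = V)
    (hfE : IsNewformOf E fE) (hfV : IsNewformOf V fV) {c : ℚ} (hc : c ≠ 0)
    (hper : (c : ℝ) ^ 2 * (d.natAbs : ℝ) * plusPeriod fV ^ 2 = minusPeriod fE ^ 2)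
    {μE : ℚ} (hμE0 : μE ≠ 0) (hμE : (μE : ℝ) * E.imaginaryPeriodRat = minusPeriod fE) :
    (μE / (|c * (C₀.u : ℚ)| * ((E.baseChange ℝ).numRealComponents : ℚ))) ≠ 0 ∧
      (((μE / (|c * (C₀.u : ℚ)| * ((E.baseChange ℝ).numRealComponents : ℚ))) : ℚ) : ℝ) * V.realPeriodRat =
        plusPeriod fV ∧
      padicValRat 2 (μE / (|c * (C₀.u : ℚ)| * ((E.baseChange ℝ).numRealComponents : ℚ))) =
        padicValRat 2 μE - padicValRat 2 c - padicValRat 2 (C₀.u : ℚ) -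
          padicValRat 2 ((E.baseChange ℝ).numRealComponents : ℚ) := by
  have hu : (C₀.u : ℚ) ≠ 0 := Units.ne_zero _
  have hn : 0 < (E.baseChange ℝ).numRealComponents := numRealComponents_baseChange_pos E
  have hnq : ((E.baseChange ℝ).numRealComponents : ℚ) ≠ 0 := by exact_mod_cast hn.ne'
  have hPV : 0 < plusPeriod fV := IsNewform0.plusPeriod_pos_holds hfV.1 hfV.coeffField_eq_bot
  have hPE : 0 < minusPeriod fE := IsNewform0.minusPeriod_pos_holds hfE.1 hfE.coeffField_eq_bot
  have hdq : ((d : ℚ)) < 0 := by exact_mod_cast hd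
  have hPal := E.realPeriodRat_mul_sqrt_of_twist_of_neg' hdq V C₀ hV
  have hdm : (d.natAbs : ℝ) = -((d : ℚ) : ℝ) := by
    rw [← Int.cast_natCast (R := ℝ) d.natAbs, Int.natCast_natAbs, Int.cast_abs, Rat.cast_intCast,
      abs_of_neg (by exact_mod_cast hd : (d : ℝ) < 0)]
  have hD : (0 : ℝ) < (d.natAbs : ℝ) := by rw [hdm]; push_cast; exact_mod_cast neg_pos.mpr hd
  have hPal' : V.realPeriodRat * Real.sqrt (d.natAbs : ℝ) =
      |((C₀.u : ℚ) : ℝ)| * ((E.baseChange ℝ).numRealComponents : ℕ) * E.imaginaryPeriodRat := by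
    rw [hdm]; exact hPal
  refine ⟨div_ne_zero hμE0 (mul_ne_zero (abs_ne_zero.mpr (mul_ne_zero hc hu)) hnq), ?_,
    padicValRat_div_abs_mul_mul hμE0 hc hu hnq⟩
  have h := plusPeriodRatio_negTwist_of_birch (n := (E.baseChange ℝ).numRealComponents) hD hc hu hn hPV hPE hper hμE
    hPal'
  have e : (((μE / (|c * (C₀.u : ℚ)| * ((E.baseChange ℝ).numRealComponents : ℚ))) : ℚ) : ℝ) =
      ((μE / (|c * (C₀.u : ℚ)| * ((E.baseChange ℝ).numRealComponents : ℕ)) : ℚ) : ℝ) := by norm_cast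
  rw [e]
  exact h

/-- ★★★ **Cancellation of Birch's constant for a NEGATIVE twist.** In the setting of `deriv_padicLFunction_negTwist_eq` with a
minus period ratio `μ_E·|Ω⁻(E)| = Ω⁻_{f_E}` of the base: there is a plus period ratio `ϖ_V` of the twist such that the minus tame
function `G⁻` vanishes at `−2`, `D_V ≠ 0 ↔ D_{G⁻} ≠ 0`, and, when `D_{G⁻} ≠ 0`,
**`v₂(D_V) + v₂(ϖ_V) + v₂(u(C₀)) + v₂(c_∞(E)) = v₂(D_{G⁻}) + v₂(μ_E)`**.
[cite: MazurTateTeitelbaum1986Invent, §I.8 and §I.13] [cite: Pal2012, Thm. 3.2 (case d < 0)] -/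
theorem valuation_deriv_add_plusPeriodRatio_negTwist (hmod : exists_isNewformOf) (hd : d < 0) (hd4 : d % 4 = 1)
    (hsq : Squarefree d) (hcop : IsCoprime d (E.conductorNorm ℤ : ℤ)) {C₀ : VariableChange ℚ}
    (hV : C₀ • E.quadraticTwist (d : ℚ) = V) (hfE : IsNewformOf E fE) (hfV : IsNewformOf V fV)
    (hord : IsOrdinaryAt E 2) {χ : MulChar (ZMod d.natAbs) ℤ}
    (hχ : ∀ a : ZMod d.natAbs, χ a = J((a.val : ℤ) | d.natAbs))
    (h0 : HasSum (fun k : ℕ ↦ PowerSeries.coeff k (padicLFunction fV (unitRoot V 2 : ℚ_[2])) *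
      (-2 : ℚ_[2]) ^ k) 0)
    {μE : ℚ} (hμE0 : μE ≠ 0) (hμE : (μE : ℝ) * E.imaginaryPeriodRat = minusPeriod fE) :
    ∃ ϖV : ℚ, ϖV ≠ 0 ∧ (ϖV : ℝ) * V.realPeriodRat = plusPeriod fV ∧
      HasSum (fun k : ℕ ↦ PowerSeries.coeff k (padicLFunctionTameMinus fE d.natAbs (unitRoot E 2 : ℚ_[2])
        ((χ.ringHomComp (Int.castRingHom ℚ)).ringHomComp (Rat.castHom ℚ_[2]))) * (-2 : ℚ_[2]) ^ k) 0 ∧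
      ((∑' k : ℕ, PowerSeries.coeff k (padicLFunction fV (unitRoot V 2 : ℚ_[2])) * (k : ℚ_[2]) *
            (-2) ^ (k - 1)) ≠ 0 ↔
        (∑' k : ℕ, PowerSeries.coeff k (padicLFunctionTameMinus fE d.natAbs (unitRoot E 2 : ℚ_[2])
            ((χ.ringHomComp (Int.castRingHom ℚ)).ringHomComp (Rat.castHom ℚ_[2]))) * (k : ℚ_[2]) *
              (-2) ^ (k - 1)) ≠ 0) ∧
      ((∑' k : ℕ, PowerSeries.coeff k (padicLFunctionTameMinus fE d.natAbs (unitRoot E 2 : ℚ_[2])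
            ((χ.ringHomComp (Int.castRingHom ℚ)).ringHomComp (Rat.castHom ℚ_[2]))) * (k : ℚ_[2]) *
              (-2) ^ (k - 1)) ≠ 0 →
        (∑' k : ℕ, PowerSeries.coeff k (padicLFunction fV (unitRoot V 2 : ℚ_[2])) * (k : ℚ_[2]) *
            (-2) ^ (k - 1)).valuation + padicValRat 2 ϖV + padicValRat 2 (C₀.u : ℚ) +
            padicValRat 2 ((E.baseChange ℝ).numRealComponents : ℚ) =
          (∑' k : ℕ, PowerSeries.coeff k (padicLFunctionTameMinus fE d.natAbs (unitRoot E 2 : ℚ_[2])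
            ((χ.ringHomComp (Int.castRingHom ℚ)).ringHomComp (Rat.castHom ℚ_[2]))) * (k : ℚ_[2]) *
              (-2) ^ (k - 1)).valuation + padicValRat 2 μE) := by
  obtain ⟨c, hc0, hper, hGsum, hiff, hval⟩ :=
    valuation_deriv_padicLFunction_negTwist_eq E hmod hd hd4 hsq hcop hV hfE hfV hord hχ h0
  obtain ⟨hϖV0, hϖV, hvϖV⟩ := exists_plusPeriodRatio_negTwist E hd hV hfE hfV hc0 hper hμE0 hμE
  refine ⟨_, hϖV0, hϖV, hGsum, hiff, fun hG ↦ ?_⟩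
  rw [hval hG, hvϖV]
  ring

end TransportNeg

variable (ι : PadicAlgCl 2 ≃+* ℂ) (K : Type) [Field K] [NumberField K] [IsGalois ℚ K]

/-! ### §3 The `χ₈`-class defect key in BASE currency, negative twist parameter -/

/-- ★★★ **The defect key of the `χ₈∘N`-class MODULO (Δ1), in BASE currency, for a NEGATIVE twist parameter.** Setting of
`defectKey_chi8_modulo_descent_min` for a globally minimal member `W` over the good curve `V = C₀ • E^{(d)}` with `d < 0`,
`d ≡ 1 (4)`, squarefree, `(d, N_E) = 1`, the base `E` (globally minimal, good ordinary at `2`) carrying a MINUS period ratio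
`μ_E·|Ω⁻(E)| = Ω⁻_{f_E}`: with `G⁻ = L⁻₂(f_E, |d|, α_E, χ_d, ·)` the `χ_d`-twisted `2`-adic `L`-function of the MINUS tame measure
of the FIXED form and `D_{G⁻} = Σ_k k[T^k]G⁻(−2)^{k−1}`:
`D_{G⁻} ≠ 0 ∧ shaAn W = q ∈ ℚˣ ∧ v₂(q) + v₂(Tam W) + v₂(h₂) + v₂(u(C₀)) + v₂(c_∞(E)) = v₂(D_{G⁻}) + 2 + 2v₂(#W(ℚ)_tors) + v₂(μ_E)`.
[cite: Disegni2017, Theorem B] [cite: MazurTateTeitelbaum1986Invent, §I.8 and §I.13] [cite: Pal2012, Thm. 3.2 (case d < 0)] -/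
theorem defectKey_chi8_base_currency_neg (hGZ73 : GrossZagier1986_thm_I_7_3) (h2 : Module.finrank ℚ K = 2)
    (hsplit : ((Ideal.span {(2 : ℤ)}).primesOver (𝓞 K)).ncard = 2)
    (𝔭 𝔭' : HeightOneSpectrum (𝓞 K)) (h𝔭 : ((2 : ℕ) : 𝓞 K) ∈ 𝔭.asIdeal)
    (h𝔭' : ((2 : ℕ) : 𝓞 K) ∈ 𝔭'.asIdeal)
    (κ : DirichletCharacter ℂ (NumberField.discr K).natAbs)
    (hκ : ∀ ℓ : ℕ, ℓ.Prime → ℓ ≠ 2 → κ ℓ = (jacobiSym (NumberField.discr K) ℓ : ℂ))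
    (hκ2 : κ 2 = if NumberField.discr K % 8 = 1 then 1 else if NumberField.discr K % 8 = 5 then -1 else 0)
    (hd : Nat.Coprime 2 (NumberField.discr K).natAbs)
    -- the base curve, the twist parameter and the good pair
    (E : WeierstrassCurve ℚ) [E.IsElliptic] [E.IsGloballyMinimal] [NeZero (E.conductorNorm ℤ)]
    {fE : CuspForm (Gamma0 (E.conductorNorm ℤ)) 2} (hfE : IsNewformOf E fE) (hordE : IsOrdinaryAt E 2)
    (hmodf : exists_isNewformOf) {d : ℤ} [NeZero d.natAbs] (hd0 : d < 0) (hd4 : d % 4 = 1) (hsq : Squarefree d)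
    (hcop : IsCoprime d (E.conductorNorm ℤ : ℤ)) {χJ : MulChar (ZMod d.natAbs) ℤ}
    (hχJ : ∀ a : ZMod d.natAbs, χJ a = J((a.val : ℤ) | d.natAbs))
    {μE : ℚ} (hμE0 : μE ≠ 0) (hμE : (μE : ℝ) * E.imaginaryPeriodRat = minusPeriod fE)
    (V V' : WeierstrassCurve ℚ) [V.IsElliptic] [V.IsGloballyMinimal] [V'.IsElliptic] [V'.IsGloballyMinimal]
    [NeZero (V.conductorNorm ℤ)] {C₀ : VariableChange ℚ} (hV : C₀ • E.quadraticTwist (d : ℚ) = V)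
    (hordV' : IsOrdinaryAt V' 2) (hap : V'.frobeniusTrace 2 = V.frobeniusTrace 2)
    {N' : ℕ} [NeZero N'] {f : CuspForm (Gamma0 (V.conductorNorm ℤ)) 2}
    {f' : CuspForm (Gamma0 N') 2} (hfV : IsNewformOf V f) (hfV' : IsNewformOf V' f')
    (hV' : ∀ n : ℕ, cuspCoeff f' n = κ (n : ZMod _) * cuspCoeff f n)
    (h0 : HasSum (fun k : ℕ ↦ PowerSeries.coeff k (padicLFunction f (unitRoot V 2 : ℚ_[2])) *
      (-2 : ℚ_[2]) ^ k) 0)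
    -- the member (analytic rank one, rank one) and its companion
    (hmod : hasEntireLFunction_rat) {M M' : ℕ} [NeZero M] [NeZero M']
    {g : CuspForm (Gamma0 M) 2} {g' : CuspForm (Gamma0 M') 2}
    (W W' : WeierstrassCurve ℚ) [W.IsElliptic] [W.IsGloballyMinimal] [W'.IsElliptic]
    (hg : IsNewformOf W g) (hg' : IsNewformOf W' g')
    (hgε : ∀ m : ℕ, cuspCoeff g m = (ZMod.χ₈.ringHomComp (Int.castRingHom ℂ)) m * cuspCoeff f m)
    (hg'ε : ∀ m : ℕ, cuspCoeff g' m = (ZMod.χ₈.ringHomComp (Int.castRingHom ℂ)) m * cuspCoeff f' m)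
    (hr : W.analyticRank = 1) (hrk : W.mordellWeilRank = 1) (hL' : W'.entireLFunction 1 ≠ 0)
    -- the tower frame and the sign character
    {H : Type} [Field H] [NumberField H] [Algebra K H] (hKH : Module.finrank K H = 2) {t : H}
    (htK : t ∉ Set.range (algebraMap K H)) (ht2 : t ^ 2 = algebraMap ℚ H 2)
    (G : Subgroup (H ≃ₐ[ℚ] H)) (χ : G →* ℂˣ) (s : G → ℤ) (hs : ∀ σ, ((χ σ : ℂˣ) : ℂ) = (s σ : ℂ))
    (τ : H ≃ₐ[ℚ] H) (hτG : τ ∈ G) (hsτ : s ⟨τ, hτG⟩ = -1)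
    (hτK : ∀ a : K, τ (algebraMap K H a) = algebraMap K H a) (hτt : τ t = -t)
    {u : K} {e : ℚ} (hu : u ∉ Set.range (algebraMap ℚ K)) (hue : u ^ 2 = algebraMap ℚ K e)
    (c : K ≃ₐ[ℚ] K) (hcu : c u = -u)
    -- the member's explicit model `V^{(2)} = C • W` and its Mordell–Weil generator
    [(V.quadraticTwist 2).IsElliptic] {C : VariableChange ℚ} (hC : C • W = V.quadraticTwist 2)
    {P : (V.quadraticTwist 2).toAffine.Point}
    (hgen : ∀ R : (V.quadraticTwist 2).toAffine.Point,
      ∃ (k : ℤ) (T : (V.quadraticTwist 2).toAffine.Point), IsOfFinAddOrder T ∧ R = k • P + T)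
    (htors : ∀ Q : ((V.quadraticTwist 2).quadraticTwist e).toAffine.Point, IsOfFinAddOrder Q)
    -- Disegni's datum: invariance, PIN, and the conjoined clauses (PRINT stub of the road)
    (DH : PAdicHeightDataK V 2 H)
    (hDH : ∀ (σ : G) (a b : (V.baseChange H).toAffine.Point),
      DH.pairing (pointGalHom V H σ.1 a) (pointGalHom V H σ.1 b) = DH.pairing a b)
    {h₂ : ℚ_[2]}
    (hpin : DH.pairing
      (twistPointEquivOver V (not_mem_range_rat_of_not_mem_range htK) ht2
        (QuadraticDescent.incl H (V.quadraticTwist 2) P))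
      (twistPointEquivOver V (not_mem_range_rat_of_not_mem_range htK) ht2
        (QuadraticDescent.incl H (V.quadraticTwist 2) P)) = h₂)
    (hGZ : ChiLineGrossZagierClauses ι K V H f (ι (((unitRoot V 2 : ℚ_[2]) : PadicAlgCl 2)))
      (baseChangeDirichlet K (ZMod.χ₈.ringHomComp (Int.castRingHom ℂ))) 𝔭 𝔭' G χ DH)
    -- Bertrand: the 2-adic height of the member's generator is non-zero
    (hh₂ : h₂ ≠ 0) :
    (∑' k : ℕ, PowerSeries.coeff k (padicLFunctionTameMinus fE d.natAbs (unitRoot E 2 : ℚ_[2])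
        ((χJ.ringHomComp (Int.castRingHom ℚ)).ringHomComp (Rat.castHom ℚ_[2]))) * (k : ℚ_[2]) *
          (-2) ^ (k - 1)) ≠ 0 ∧
    ∃ q : ℚ, shaAn W = (q : ℂ) ∧ q ≠ 0 ∧
      padicValRat 2 q + (padicValNat 2 W.tamagawaProduct : ℤ) + h₂.valuation + padicValRat 2 (C₀.u : ℚ) +
          padicValRat 2 ((E.baseChange ℝ).numRealComponents : ℚ) =
        (∑' k : ℕ, PowerSeries.coeff k (padicLFunctionTameMinus fE d.natAbs (unitRoot E 2 : ℚ_[2])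
            ((χJ.ringHomComp (Int.castRingHom ℚ)).ringHomComp (Rat.castHom ℚ_[2]))) * (k : ℚ_[2]) *
              (-2) ^ (k - 1)).valuation + 2 +
          2 * (padicValNat 2 W.torsionOrder : ℤ) + padicValRat 2 μE := by
  obtain ⟨hordV, -⟩ := exists_birchConstant_two_neg E hmodf hd0 hd4 hsq hcop hV hfE hfV hordE hχJ
  have hN : ¬ 2 ∣ V.conductorNorm ℤ := not_two_dvd_level_of_isOrdinaryAt hfV hordV
  obtain ⟨ϖV, hϖV0, hϖV, -, hiff, hval⟩ := valuation_deriv_add_plusPeriodRatio_negTwist E hmodf hd0 hd4 hsq hcop hV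
    hfE hfV hordE hχJ h0 hμE0 hμE
  obtain ⟨hD, q, hq, hq0, hv⟩ := defectKey_chi8_modulo_descent_min ι K hGZ73 h2 hsplit 𝔭 𝔭' h𝔭 h𝔭' κ hκ hκ2 hd V V'
    hordV hordV' hap hN hfV hfV' hV' h0 hmod W W' hg hg' hgε hg'ε hr hrk hL' hKH htK ht2 G χ s hs τ hτG hsτ hτK hτt hu
    hue c hcu hC hgen htors DH hDH hpin hGZ hϖV0 hϖV hh₂
  have hDG := hiff.mp hD
  refine ⟨hDG, q, hq, hq0, ?_⟩
  have hkey := hval hDG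
  linear_combination hv + hkey

end Summit.BirchSwinnertonDyer.BirchSwinnertonDyer.Theorems.PrintCf2.DisegniPairTwo

end
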